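import Summits.BirchSwinnertonDyer.BirchSwinnertonDyer.Theorems.PrintX10bTwoSidedLinkAnyClassNumberX10bOfPrintFactsPinned
import Summits.BirchSwinnertonDyer.Rank1Residual.Partition.MainConjecturesIrreducibleBDP
import HarnessLib

/-!
# TURNKEY for the pinned B₃ (`TwoSidedLinkAnyClassNumberX10bPinned[OfPrint]`, PrintX10b rev 20 per PIN-1 (R3)):
# the TWO-SIDED link `X11b.IMCWaldspurgerOnTreeGoodAt p κ (inducedPlace ι) γ ι P` at every good ordinary
# `p ≥ 3`, (irr_K), rank one, `Ш[p^∞]` finite, `p ∤ c(Dt)`, GRANTED Howard's containment for a Heegner family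
# TIED to the frame's parametrisation (`F.Dt = Dt`) — AT EVERY CLASS NUMBER, modulo the four single-source
# print facts, the pinned class-number-free transfer `h59gp` ((T2)-general at `s = 1`) and JSW 2017 Thm. 3.3.1

Cell `run/shared/lean/pub/bsd-print-x9/`, seat `bsd-line-x10b-p3` (D-0154 row 10; crux stmt-BirchSwinnertonDyer-23730,
line `composite-transfer-x10b`). HONEST FRAMING: theorems only (no definition, no named fact, no `sorry`);
`--supports stmt-BirchSwinnertonDyer-23730` (helper); route-independent (no `Theses` import: the pinned
route items do not exist yet — PrintX10b rev 20 / PrintX9 rev 20 are the planner's); nothing is closed;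
BSD is not proved by any of this and no summit statement is proved by this seat.

* `imcWaldspurgerOnTreeGoodAt_inducedPlace_of_printFacts_of_pinnedTransfer` — the landed
  `X11b.imcWaldspurgerOnTreeGoodAt_inducedPlace_of_heegnerContainment_of_thm331` (PrintX9HowardIMCLink §1) with
  (i) the binder `¬ p ∣ h_K` DELETED, (ii) `hYZ` replaced by `h57` (Yan–Zhu Thm. 5.7 (1)), `h59gp` (the PINNED
  class-number-free transfer), `h422` (BCS Prop. 4.2.2), `h513` (CGLS Thm. 5.1.3), `hC` (Carayol), and
  (iii) the containment hypothesis in the TIED item form of PIN-1 (R1)/(R3):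
  `∃ jbar D (F : HeegnerFamily N W K κ jbar) X, F.Dt = Dt ∧ heegnerCharIdeal D F ^ 2 ≤ char(torsion X.X)`
  (with the frame's `¬ (p : ℤ) ∣ Dt.c` this is the fact-style pin `¬ (p : ℤ) ∣ F.Dt.c`). The σ-bridge is the
  tree's `X11b.*` API verbatim. This is PIN-1's turnkey T-G at every class number (serves PrintX9's
  `TwoSidedLinkPinnedOfPrint` and PrintX10b's `TwoSidedLinkAnyClassNumberX10bPinnedOfPrint` alike).
* `twoSidedLinkAnyClassNumberX10bPinned_of_printFacts_of_pinnedTransfer` — the same read on the binder list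
  of crux 23730 (`ClassX10 W p`, `¬ Surj W 3`, `¬ CM`, …) with the pinned hypothesis: the body the planner
  announced for `TwoSidedLinkAnyClassNumberX10bPinned` (PIN-1 (R3)), proved modulo
  `(h57, h59gp, h422, h513, hC, h331)`; the route-level corollary is one `exact` once rev 20 lands.

References: [YanZhu2024MainConjNonCM] §5.2, Thm. 5.7 (1), Thm. 5.9; [BurungaleCastellaSkinner2025] Prop.
4.2.2; [CastellaGrossiLeeSkinner2022] Thm. 5.1.3; [JetchevSkinnerWan2017] Thm. 3.3.1, §2.3.2, §7.4.1;
[Castella2018] Thm. 2.3, §5 (eq:IMC+BDP); [PerrinRiou1987BSMF] §1 Conj. B; [Carayol1986];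
HOME/plan/findings/PIN-1-unpinned-heegner-family.md (R1)–(R3); HOME/REF-AUDIT.md REF-104.
-/

-- the summit and its single problem are both named `BirchSwinnertonDyer` (registry layout D-0017)
set_option linter.dupNamespace false
set_option autoImplicit false

noncomputable section

open scoped Classical

open WeierstrassCurve NumberField IsDedekindDomain Field Literature.NumberTheory.EllipticCurves
  Literature.NumberTheory.EllipticCurves.ModularForms Literature.NumberTheory.EllipticCurves.Rank1Residual
  Literature.NumberTheory.EllipticCurves.Castella2018 Literature.NumberTheory.EllipticCurves.YanZhu2026
  Literature.NumberTheory.EllipticCurves.CastellaGrossiLeeSkinner2022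
  Literature.NumberTheory.EllipticCurves.JetchevSkinnerWan2017

open Summit.BirchSwinnertonDyer.Rank1Residual

namespace Summit.BirchSwinnertonDyer.BirchSwinnertonDyer.Cruxes.TwoSidedLinkAnyClassNumberX10b.CompositeTransferX10b

/-- **PIN-1 turnkey T-G at every class number: the TWO-SIDED link `X11b.IMCWaldspurgerOnTreeGoodAt p κ
(inducedPlace ι) γ ι P` at a good ordinary `p ≥ 3`, (irr_K), rank one, `Ш[p^∞]` finite, `p ∤ c(Dt)`, GRANTED
Howard's containment for a family TIED to `Dt`** (`∃ jbar D F X, F.Dt = Dt ∧ I(ℋ_F)² ⊆ char(X_tors)`), modulo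
`h57` (Yan–Zhu Thm. 5.7 (1)), the PINNED class-number-free transfer `h59gp` ((T2)-general at `s = 1`),
`h422` (BCS Prop. 4.2.2), `h513` (CGLS Thm. 5.1.3), `hC` (Carayol) and `h331` (JSW Thm. 3.3.1): the other
prime `w ∣ p`, THE embedding `embAt w`, the JSW generator at `(ι, inducedPlace ι)`, the pinned composite
valuation (`compositeValuation_of_printFacts_of_pinnedTransfer`, the tie giving `¬ p ∣ c(F.Dt)` from
`¬ p ∣ c(Dt)`) at `(embAt w, inducedPlace ι)`, an involution `σ` with `embAt w = ι ∘ σ`, `ord_p log`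
invariance in rank one, `ord_p c(Dt) = 0`. NO hypothesis on `h_K`, NO image hypothesis.
[cite: YanZhu2024MainConjNonCM, Thm. 5.7 (1) and Thm. 5.9, §5.2] [cite: BurungaleCastellaSkinner2025, Prop. 4.2.2]
[cite: CastellaGrossiLeeSkinner2022, Thm. 5.1.3] [cite: JetchevSkinnerWan2017, Thm. 3.3.1, §2.3.2, §7.4.1]
[cite: Castella2018, Thm. 2.3, §5 (eq:IMC+BDP)] [cite: PerrinRiou1987BSMF, §1 Conj. B (the normalisation `c_π`)] -/
theorem imcWaldspurgerOnTreeGoodAt_inducedPlace_of_printFacts_of_pinnedTransfer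
    (h57 : thm57_isTorsion_charIdealXGr_eq_bdpLFunction)
    (h59gp : ∀ {p : ℕ} [Fact p.Prime] (ι' : PadicAlgCl p ≃+* ℂ) (W : WeierstrassCurve ℚ) [W.IsElliptic]
      [W.IsGloballyMinimal] (K : Type) [Field K] [NumberField K] (v vbar : HeightOneSpectrum (𝓞 K))
      (κ : ZpExtension K p) (γ : absoluteGaloisGroup K) [Fact (κ.IsTopGenerator γ)] {N : ℕ} [NeZero N]
      {f : CuspForm (CongruenceSubgroup.Gamma0 N) 2} (jbar : AlgebraicClosure K →+* ℂ)
      (_ : IsNewformOf W f),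
      N = W.conductorNorm ℤ → 3 ≤ p → GoodOrd W p → (W.baseChange K).HasIrreducibleModPGaloisRep p →
      IsImaginaryQuadratic K → SatisfiesHeegnerHypothesis N K →
        ((Ideal.span {(p : ℤ)}).primesOver (𝓞 K)).ncard = 2 →
        Odd (NumberField.discr K) → NumberField.discr K ≠ -3 → κ.IsAnticyclotomic →
      (∀ (w : InfinitePlace K) (k : 𝓞 K), k ∈ v.asIdeal ↔ ‖ι'.symm (w.embedding (k : K))‖ < 1) →
        ((p : ℕ) : 𝓞 K) ∈ vbar.asIdeal → vbar ≠ v →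
      ∃ (ΩK : ℂ) (Ωp : (unrIntegers p)ˣ) (L : UnrSeries p),
        ΩK ≠ 0 ∧ IsBDPLFunction ι' v κ γ f ΩK ((Ωp : unrIntegers p) : ℂ_[p]) L ∧
        ∀ (D : (W.baseChange K).LambdaAdicSelmerData κ γ) (F : HeegnerFamily N W K κ jbar)
          (X : (W.baseChange K).SelmerDualData κ γ) (j : ℤ_[p] →+* unrIntegers p),
          ¬ (p : ℤ) ∣ F.Dt.c →
          (∀ x : ℤ_[p], ((j x : unrIntegers p) : ℂ_[p]) = algebraMap ℚ_[p] ℂ_[p] (x : ℚ_[p])) →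
          heegnerCharIdeal D F ^ 2 ≤
              Module.charIdeal (IwasawaAlgebra p) (Submodule.torsion (IwasawaAlgebra p) X.X) →
            L ∈ (AcSelmer.XAc.charIdeal (W.baseChange K) p κ vbar ∅ γ).map (PowerSeries.map j))
    (h422 : BurungaleCastellaSkinner2025.prop422_exists_isBDPLFunction_mu_eq_zero)
    (h513 : thm513_exists_isBDPLFunction_valueAtOne_disc)
    (hC : ∀ (N : ℕ) [NeZero N], IsNewformOf.level_eq_conductorNorm (N := N))
    (h331 : thm331_anticyclotomicControl)
    {W : WeierstrassCurve ℚ} [W.IsElliptic] [W.IsGloballyMinimal] {p : ℕ} [Fact p.Prime]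
    {K : Type} [Field K] [NumberField K]
    (hp : 3 ≤ p) (hord : GoodOrd W p)
    (hK : IsImaginaryQuadratic K) (hodd : Odd (NumberField.discr K)) (h3 : NumberField.discr K ≠ -3)
    {N : ℕ} [NeZero N] (hN : W.conductorNorm ℤ = N) (hHN : SatisfiesHeegnerHypothesis N K)
    (hHp : SatisfiesHeegnerHypothesis p K) (hirrK : (W.baseChange K).HasIrreducibleModPGaloisRep p)
    (ι : K →+* ℚ_[p]) (κ : ZpExtension K p) (hκ : κ.IsAnticyclotomic)
    (γ : Field.absoluteGaloisGroup K) [Fact (κ.IsTopGenerator γ)]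
    (Dt : ModularParametrizationData W N) (hc : ¬ (p : ℤ) ∣ Dt.c)
    (H : HeegnerDatum N (NumberField.discr K)) (ιC : K →+* ℂ) (P : (W.baseChange K).toAffine.Point)
    (hP : WeierstrassCurve.Affine.Point.map ιC.toRatAlgHom P = heegnerPointComplex Dt H)
    (hrk : (W.baseChange K).mordellWeilRank = 1)
    (hfinp : Finite (AddCommGroup.primaryComponent (W.baseChange K).sha p))
    (hPinf : ¬ IsOfFinAddOrder P)
    (hHow : ∃ (jbar : AlgebraicClosure K →+* ℂ) (D : (W.baseChange K).LambdaAdicSelmerData κ γ)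
      (F : HeegnerFamily N W K κ jbar) (X : (W.baseChange K).SelmerDualData κ γ),
      F.Dt = Dt ∧ heegnerCharIdeal D F ^ 2 ≤
        Module.charIdeal (IwasawaAlgebra p) (Submodule.torsion (IwasawaAlgebra p) X.X)) :
    X11b.IMCWaldspurgerOnTreeGoodAt p κ (X11b.inducedPlace ι) γ ι P := by
  have hHN' : SatisfiesHeegnerHypothesis (W.conductorNorm ℤ) K := by rw [hN]; exact hHN
  -- the tie gives the fact-style pin `¬ p ∣ c(F.Dt)`
  have hHow' : ∃ (jbar : AlgebraicClosure K →+* ℂ) (D : (W.baseChange K).LambdaAdicSelmerData κ γ)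
      (F : HeegnerFamily N W K κ jbar) (X : (W.baseChange K).SelmerDualData κ γ),
      ¬ (p : ℤ) ∣ F.Dt.c ∧ heegnerCharIdeal D F ^ 2 ≤
        Module.charIdeal (IwasawaAlgebra p) (Submodule.torsion (IwasawaAlgebra p) X.X) := by
    obtain ⟨jbar, D, F, X, hFD, hle⟩ := hHow
    exact ⟨jbar, D, F, X, by rw [hFD]; exact hc, hle⟩
  -- the other prime `w` above `p`, of degree one, and THE embedding at it
  obtain ⟨w, hw, hwne⟩ := X11b.exists_other_prime hHp (X11b.inducedPlace ι)
    (X11b.natCast_mem_inducedPlace ι)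
  have hsplit : X11b.SplitsIn K p := hHp p Fact.out (dvd_refl p)
  obtain ⟨he, hf⟩ := X11b.degreeOne_of_splitsIn hK.1 hsplit hw
  set ιw : K →+* ℚ_[p] := X11b.embAt K p w hw he hf with hιw
  -- a generator with non-zero constant term of the module strict at `v = inducedPlace ι`, from JSW
  obtain ⟨-, F, hF, hF0, -⟩ := h331 W p hp hord.1 K hK hHp hHN' hirrK ι (X11b.inducedPlace ι)
    (X11b.mem_inducedPlace_iff ι) κ hκ γ hrk hfinp P hPinf
  -- the pinned class-number-free composite at the embedding `ιw`, strict prime `inducedPlace ι`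
  obtain ⟨n, hn, hval⟩ := compositeValuation_of_printFacts_of_pinnedTransfer h57 h59gp h422 h513 hC W p
    hp hord K hK hHN' hHp hodd h3 hirrK ιw w (X11b.inducedPlace ι)
    (X11b.mem_asIdeal_iff_norm_embAt_lt_one w hw he hf) (X11b.natCast_mem_inducedPlace ι)
    (fun h ↦ hwne h.symm) κ hκ γ N Dt H ιC P hP hHow' F hF hF0
  -- `ιw = ι ∘ σ` for an involution `σ`; the log valuations agree in rank one
  obtain ⟨σ, hσ, hισ⟩ := X11b.exists_involutive_comp_eq hK.1 ι ιw
  have hlog : Literature.NumberTheory.EllipticCurves.padicLogOrd W p ιw P = X11b.padicLogOrd W p ι P := by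
    rw [← hισ, ← X11b.padicLogOrd_eq_literature]
    exact padicLogOrd_comp_eq_of_rank_one W p (by omega) σ hσ ι hrk P hPinf
  have hc0 : padicValInt p Dt.c = 0 := padicValInt.eq_zero_of_not_dvd hc
  refine ⟨n, (X11b.AcSelmer.hasCharValuationAt_iff_literature _ p κ (X11b.inducedPlace ι) ∅ γ n).mpr hn,
    ?_⟩
  rw [hlog] at hval
  omega

/-- **The pinned B₃ on the binder list of crux stmt-BirchSwinnertonDyer-23730** (`ClassX10 W p`, `¬ Surj W 3`,
`¬ CM`, `K` imaginary quadratic with `d_K` odd `≠ −3`, Heegner for `N_E` and `p`, (irr_K), `ι`, `κ`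
anticyclotomic with generator `γ`, `Dt` with `p ∤ c(Dt)`, `H`, `ιC`, `P ↦ y_K`, rank one, `Ш[p^∞]` finite, `P`
non-torsion) with the containment hypothesis PINNED by the tie `F.Dt = Dt` — the body announced for
`PrintX10b.TwoSidedLinkAnyClassNumberX10bPinned` (PIN-1 (R3)) — AT EVERY CLASS NUMBER, modulo
`(h57, h59gp, h422, h513, hC, h331)`. `ClassX10` supplies `3 ≤ p` and `GoodOrd W p`; the rest is the theorem
above. [cite: YanZhu2024MainConjNonCM, Thm. 5.7 (1) and Thm. 5.9] [cite: BurungaleCastellaSkinner2025, Prop. 4.2.2]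
[cite: CastellaGrossiLeeSkinner2022, Thm. 5.1.3] [cite: JetchevSkinnerWan2017, Thm. 3.3.1] [cite: Carayol1986] -/
theorem twoSidedLinkAnyClassNumberX10bPinned_of_printFacts_of_pinnedTransfer
    (h57 : thm57_isTorsion_charIdealXGr_eq_bdpLFunction)
    (h59gp : ∀ {p : ℕ} [Fact p.Prime] (ι' : PadicAlgCl p ≃+* ℂ) (W : WeierstrassCurve ℚ) [W.IsElliptic]
      [W.IsGloballyMinimal] (K : Type) [Field K] [NumberField K] (v vbar : HeightOneSpectrum (𝓞 K))
      (κ : ZpExtension K p) (γ : absoluteGaloisGroup K) [Fact (κ.IsTopGenerator γ)] {N : ℕ} [NeZero N]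
      {f : CuspForm (CongruenceSubgroup.Gamma0 N) 2} (jbar : AlgebraicClosure K →+* ℂ)
      (_ : IsNewformOf W f),
      N = W.conductorNorm ℤ → 3 ≤ p → GoodOrd W p → (W.baseChange K).HasIrreducibleModPGaloisRep p →
      IsImaginaryQuadratic K → SatisfiesHeegnerHypothesis N K →
        ((Ideal.span {(p : ℤ)}).primesOver (𝓞 K)).ncard = 2 →
        Odd (NumberField.discr K) → NumberField.discr K ≠ -3 → κ.IsAnticyclotomic →
      (∀ (w : InfinitePlace K) (k : 𝓞 K), k ∈ v.asIdeal ↔ ‖ι'.symm (w.embedding (k : K))‖ < 1) →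
        ((p : ℕ) : 𝓞 K) ∈ vbar.asIdeal → vbar ≠ v →
      ∃ (ΩK : ℂ) (Ωp : (unrIntegers p)ˣ) (L : UnrSeries p),
        ΩK ≠ 0 ∧ IsBDPLFunction ι' v κ γ f ΩK ((Ωp : unrIntegers p) : ℂ_[p]) L ∧
        ∀ (D : (W.baseChange K).LambdaAdicSelmerData κ γ) (F : HeegnerFamily N W K κ jbar)
          (X : (W.baseChange K).SelmerDualData κ γ) (j : ℤ_[p] →+* unrIntegers p),
          ¬ (p : ℤ) ∣ F.Dt.c →
          (∀ x : ℤ_[p], ((j x : unrIntegers p) : ℂ_[p]) = algebraMap ℚ_[p] ℂ_[p] (x : ℚ_[p])) →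
          heegnerCharIdeal D F ^ 2 ≤
              Module.charIdeal (IwasawaAlgebra p) (Submodule.torsion (IwasawaAlgebra p) X.X) →
            L ∈ (AcSelmer.XAc.charIdeal (W.baseChange K) p κ vbar ∅ γ).map (PowerSeries.map j))
    (h422 : BurungaleCastellaSkinner2025.prop422_exists_isBDPLFunction_mu_eq_zero)
    (h513 : thm513_exists_isBDPLFunction_valueAtOne_disc)
    (hC : ∀ (N : ℕ) [NeZero N], IsNewformOf.level_eq_conductorNorm (N := N))
    (h331 : thm331_anticyclotomicControl) :
    ∀ (W : WeierstrassCurve ℚ) [W.IsElliptic] [W.IsGloballyMinimal] (p : ℕ) [Fact p.Prime]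
      [NeZero (W.conductorNorm ℤ)] (K : Type) [Field K] [NumberField K],
      Literature.NumberTheory.EllipticCurves.Rank1Residual.ClassX10 W p →
      ¬ Literature.NumberTheory.EllipticCurves.Rank1Residual.Surj W 3 → ¬ W.HasCM →
      IsImaginaryQuadratic K → Odd (NumberField.discr K) → NumberField.discr K ≠ -3 →
      SatisfiesHeegnerHypothesis (W.conductorNorm ℤ) K → SatisfiesHeegnerHypothesis p K →
      (W.baseChange K).HasIrreducibleModPGaloisRep p →
      ∀ (ι : K →+* ℚ_[p]) (κ : ZpExtension K p), κ.IsAnticyclotomic →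
      ∀ (γ : Field.absoluteGaloisGroup K) [Fact (κ.IsTopGenerator γ)]
        (Dt : ModularParametrizationData W (W.conductorNorm ℤ)), ¬ (p : ℤ) ∣ Dt.c →
      ∀ (H : HeegnerDatum (W.conductorNorm ℤ) (NumberField.discr K)) (ιC : K →+* ℂ)
        (P : (W.baseChange K).toAffine.Point),
        WeierstrassCurve.Affine.Point.map ιC.toRatAlgHom P = heegnerPointComplex Dt H →
        (W.baseChange K).mordellWeilRank = 1 →
        Finite (AddCommGroup.primaryComponent (W.baseChange K).sha p) → ¬ IsOfFinAddOrder P →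
        (∃ (jbar : AlgebraicClosure K →+* ℂ) (D : (W.baseChange K).LambdaAdicSelmerData κ γ)
            (F : HeegnerFamily (W.conductorNorm ℤ) W K κ jbar) (X : (W.baseChange K).SelmerDualData κ γ),
            F.Dt = Dt ∧ heegnerCharIdeal D F ^ 2 ≤
              Module.charIdeal (IwasawaAlgebra p) (Submodule.torsion (IwasawaAlgebra p) X.X)) →
        X11b.IMCWaldspurgerOnTreeGoodAt p κ (X11b.inducedPlace ι) γ ι P := by
  intro W _ _ p _ _ K _ _ hX _hns _hcm hK hodd h3 hHN hHp hirrK ι κ hκ γ _ Dt hc H ιC P hP hrk hfinp hPinf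
    hHow
  -- `ClassX10 W p` unfolds to `p = 3 ∧ GoodOrd W 3 ∧ …`
  have hp3 : p = 3 := hX.p_eq
  subst hp3
  exact imcWaldspurgerOnTreeGoodAt_inducedPlace_of_printFacts_of_pinnedTransfer h57 h59gp h422 h513 hC h331
    le_rfl hX.2.1 hK hodd h3 rfl hHN hHp hirrK ι κ hκ γ Dt hc H ιC P hP hrk hfinp hPinf hHow

/-- **The same with Carayol supplied BY NAME by the route's modularity item** (`ModularParametrizationSupply` =
`nonempty_modularParametrizationData`, BCDT 2001; `IsNewformOf.level_eq_conductorNorm` is then a tree theorem by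
multiplicity one) — so the pinned B₃ body is proved modulo SIX named inputs all of which are Literature `Prop`s
(or the transfer `h59gp`): `thm57_isTorsion_charIdealXGr_eq_bdpLFunction`, `h59gp`,
`prop422_exists_isBDPLFunction_mu_eq_zero`, `thm513_exists_isBDPLFunction_valueAtOne_disc`,
`nonempty_modularParametrizationData`, `thm331_anticyclotomicControl`. [cite: YanZhu2024MainConjNonCM, Thm. 5.7 (1) and Thm. 5.9]
[cite: BCDTJAMS2001, Thm. A] [cite: Carayol1986] [cite: JetchevSkinnerWan2017, Thm. 3.3.1] -/
theorem twoSidedLinkAnyClassNumberX10bPinned_of_printFacts_of_pinnedTransfer_of_modularity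
    (h57 : thm57_isTorsion_charIdealXGr_eq_bdpLFunction)
    (h59gp : ∀ {p : ℕ} [Fact p.Prime] (ι' : PadicAlgCl p ≃+* ℂ) (W : WeierstrassCurve ℚ) [W.IsElliptic]
      [W.IsGloballyMinimal] (K : Type) [Field K] [NumberField K] (v vbar : HeightOneSpectrum (𝓞 K))
      (κ : ZpExtension K p) (γ : absoluteGaloisGroup K) [Fact (κ.IsTopGenerator γ)] {N : ℕ} [NeZero N]
      {f : CuspForm (CongruenceSubgroup.Gamma0 N) 2} (jbar : AlgebraicClosure K →+* ℂ)
      (_ : IsNewformOf W f),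
      N = W.conductorNorm ℤ → 3 ≤ p → GoodOrd W p → (W.baseChange K).HasIrreducibleModPGaloisRep p →
      IsImaginaryQuadratic K → SatisfiesHeegnerHypothesis N K →
        ((Ideal.span {(p : ℤ)}).primesOver (𝓞 K)).ncard = 2 →
        Odd (NumberField.discr K) → NumberField.discr K ≠ -3 → κ.IsAnticyclotomic →
      (∀ (w : InfinitePlace K) (k : 𝓞 K), k ∈ v.asIdeal ↔ ‖ι'.symm (w.embedding (k : K))‖ < 1) →
        ((p : ℕ) : 𝓞 K) ∈ vbar.asIdeal → vbar ≠ v →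
      ∃ (ΩK : ℂ) (Ωp : (unrIntegers p)ˣ) (L : UnrSeries p),
        ΩK ≠ 0 ∧ IsBDPLFunction ι' v κ γ f ΩK ((Ωp : unrIntegers p) : ℂ_[p]) L ∧
        ∀ (D : (W.baseChange K).LambdaAdicSelmerData κ γ) (F : HeegnerFamily N W K κ jbar)
          (X : (W.baseChange K).SelmerDualData κ γ) (j : ℤ_[p] →+* unrIntegers p),
          ¬ (p : ℤ) ∣ F.Dt.c →
          (∀ x : ℤ_[p], ((j x : unrIntegers p) : ℂ_[p]) = algebraMap ℚ_[p] ℂ_[p] (x : ℚ_[p])) →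
          heegnerCharIdeal D F ^ 2 ≤
              Module.charIdeal (IwasawaAlgebra p) (Submodule.torsion (IwasawaAlgebra p) X.X) →
            L ∈ (AcSelmer.XAc.charIdeal (W.baseChange K) p κ vbar ∅ γ).map (PowerSeries.map j))
    (h422 : BurungaleCastellaSkinner2025.prop422_exists_isBDPLFunction_mu_eq_zero)
    (h513 : thm513_exists_isBDPLFunction_valueAtOne_disc)
    (hpar : nonempty_modularParametrizationData)
    (h331 : thm331_anticyclotomicControl) :
    ∀ (W : WeierstrassCurve ℚ) [W.IsElliptic] [W.IsGloballyMinimal] (p : ℕ) [Fact p.Prime]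
      [NeZero (W.conductorNorm ℤ)] (K : Type) [Field K] [NumberField K],
      Literature.NumberTheory.EllipticCurves.Rank1Residual.ClassX10 W p →
      ¬ Literature.NumberTheory.EllipticCurves.Rank1Residual.Surj W 3 → ¬ W.HasCM →
      IsImaginaryQuadratic K → Odd (NumberField.discr K) → NumberField.discr K ≠ -3 →
      SatisfiesHeegnerHypothesis (W.conductorNorm ℤ) K → SatisfiesHeegnerHypothesis p K →
      (W.baseChange K).HasIrreducibleModPGaloisRep p →
      ∀ (ι : K →+* ℚ_[p]) (κ : ZpExtension K p), κ.IsAnticyclotomic →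
      ∀ (γ : Field.absoluteGaloisGroup K) [Fact (κ.IsTopGenerator γ)]
        (Dt : ModularParametrizationData W (W.conductorNorm ℤ)), ¬ (p : ℤ) ∣ Dt.c →
      ∀ (H : HeegnerDatum (W.conductorNorm ℤ) (NumberField.discr K)) (ιC : K →+* ℂ)
        (P : (W.baseChange K).toAffine.Point),
        WeierstrassCurve.Affine.Point.map ιC.toRatAlgHom P = heegnerPointComplex Dt H →
        (W.baseChange K).mordellWeilRank = 1 →
        Finite (AddCommGroup.primaryComponent (W.baseChange K).sha p) → ¬ IsOfFinAddOrder P →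
        (∃ (jbar : AlgebraicClosure K →+* ℂ) (D : (W.baseChange K).LambdaAdicSelmerData κ γ)
            (F : HeegnerFamily (W.conductorNorm ℤ) W K κ jbar) (X : (W.baseChange K).SelmerDualData κ γ),
            F.Dt = Dt ∧ heegnerCharIdeal D F ^ 2 ≤
              Module.charIdeal (IwasawaAlgebra p) (Submodule.torsion (IwasawaAlgebra p) X.X)) →
        X11b.IMCWaldspurgerOnTreeGoodAt p κ (X11b.inducedPlace ι) γ ι P :=
  twoSidedLinkAnyClassNumberX10bPinned_of_printFacts_of_pinnedTransfer h57 h59gp h422 h513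
    (fun _ _ ↦ IsNewformOf.level_eq_conductorNorm_of_exists_isNewformOf'
      (exists_isNewformOf_of_nonempty_modularParametrizationData hpar)) h331

end Summit.BirchSwinnertonDyer.BirchSwinnertonDyer.Cruxes.TwoSidedLinkAnyClassNumberX10b.CompositeTransferX10b

end
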